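import Mathlib.Analysis.SpecialFunctions.Pow.Real
import Literature.Analysis.FunctionSpaces.TorusCubeFieldTransfer
import Literature.Analysis.FunctionSpaces.TorusGridCells
import Literature.Analysis.FunctionSpaces.TorusCellAverages
import Literature.Analysis.FunctionSpaces.TorusCellAveragesDischarge
import Literature.Analysis.FluidPDE.QuasiSelfSimilarMixing
import Literature.Analysis.FluidPDE.QuasiSelfSimilarPlanar
import HarnessLib

/-!
# The torus family of Bruè–De Lellis 2023, Thm. 4.1 from its planar form (proofs)

Topic `Literature/Analysis/FluidPDE`; proofs file for `QuasiSelfSimilarMixing.lean`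
(`Literature.Analysis.FluidPDE.alberti_crippa_mazzucato_family`, the per-level torus rendering
of Bruè–De Lellis, CMP 400 (2023), Thm. 4.1) and `QuasiSelfSimilarPlanar.lean`
(`alberti_crippa_mazzucato_planar_family`, the same theorem in its native planar setting with the
structural clauses (4.3) + (ii) and the integer-order bounds (a)/(4.9)–(4.10)).

Main result: `alberti_crippa_mazzucato_family_of_planar` — the planar family, made `1`-periodic
by slice-wise periodisation (BDL §5, first paragraph: "Thanks to (a) and (b) we can make both
`ρ_n` and `v_n` `1`-periodic, hence defined on the `2d`-torus"), is a family in the sense of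
`alberti_crippa_mazzucato_family`, *given* the standard estimate
`Torus.eHomSobolevSeminorm_neg_one_le_of_cellAverage_eq_zero (Fin 2)` (vanishing cell averages
at mesh `N⁻¹` force `‖·‖_{Ḣ⁻¹} ≤ (C/N)‖·‖_{L²}`; named fact of `TorusCellAverages.lean`, taken as
a hypothesis until discharged). The two non-structural clauses of BDL (a)–(b) are *derived*:

* fractional Hölder orders: `‖∂ₜᵏ v_n(t)‖_{C^{j,r}} ≤ C 5^{(j+r-1)n}` from the integer-order sup
  bounds `‖Dⁱ∂ₜᵏ v_n‖_∞ ≤ Cᵢ 5^{(i-1)n}`, `i ≤ j+1`, by interpolation at scale `δ = 5⁻ⁿ`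
  (`eContDiffHolderNorm_periodize_le_of_scaling`; likewise for `v_n·∇v_n`, (4.10));
* the mixing bound `‖ρ_n(t)‖_{Ḣ⁻¹(T²)} ≤ C 5⁻ⁿ` from the zero averages on the `4·25ⁿ` cells of
  `𝒬(2·5ⁿ)` and `‖ρ_n(t)‖_{L²} = 1`.

The remaining hypothesis `alberti_crippa_mazzucato_planar_family` is the Alberti–Crippa–Mazzucato
construction itself (JAMS 2019, §§6–8), not formalised here.

## References

* E. Bruè, C. De Lellis, *Anomalous dissipation for the forced 3D Navier–Stokes equations*,
  Comm. Math. Phys. 400 (2023), Thm. 4.1, (4.3)–(4.4), (4.9)–(4.10), §5 first paragraph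
  (arXiv:2207.06301, pp. 9–10).
* G. Alberti, G. Crippa, A. L. Mazzucato, J. Amer. Math. Soc. 32 (2019), §2.5 (interpolation),
  Lemma 18 (scaling), §§6–8 (construction) (arXiv:1605.02090).
-/

noncomputable section

open Set Function Filter Metric MeasureTheory
open scoped NNReal ENNReal ContDiff InnerProductSpace

namespace Literature.Analysis.FluidPDE

open FunctionSpaces FunctionSpaces.Torus

namespace AlbertiCrippaMazzucato

/-! ## Arithmetic of the scaling `5^{(j-1)n}`; `L²` normalisation -/

/-- Monotonicity of the scaling factor in the order: `5^{(i-1)n} ≤ 5^{(j+r-1)n}` for `i ≤ j`,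
`r ≥ 0`. [folklore] -/
theorem five_rpow_scale_mono {i j : ℕ} (hij : i ≤ j) {r : ℝ} (hr : 0 ≤ r) (n : ℕ) :
    (5 : ℝ) ^ (((i : ℝ) - 1) * n) ≤ (5 : ℝ) ^ (((j : ℝ) + r - 1) * n) := by
  refine Real.rpow_le_rpow_of_exponent_le (by norm_num) ?_
  have hij' : (i : ℝ) ≤ j := by exact_mod_cast hij
  exact mul_le_mul_of_nonneg_right (by linarith) (Nat.cast_nonneg n)

/-- The two interpolation terms at scale `δ = 5^{-n}` have the common factor `5^{(j+r-1)n}`: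
`5^{jn} δ^{1-r} = 5^{(j+r-1)n}` and `5^{(j-1)n} δ^{-r} = 5^{(j+r-1)n}`. [folklore] -/
theorem five_rpow_scale_interpolate (n j : ℕ) (r : ℝ) :
    (5 : ℝ) ^ ((((j + 1 : ℕ) : ℝ) - 1) * n) * (((5 : ℝ) ^ n)⁻¹) ^ (1 - r) =
        (5 : ℝ) ^ (((j : ℝ) + r - 1) * n) ∧
      (5 : ℝ) ^ (((j : ℝ) - 1) * n) * (((5 : ℝ) ^ n)⁻¹)⁻¹ ^ r =
        (5 : ℝ) ^ (((j : ℝ) + r - 1) * n) := by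
  have h5 : (0 : ℝ) < 5 := by norm_num
  have hn : ((5 : ℝ) ^ n) = (5 : ℝ) ^ (n : ℝ) := (Real.rpow_natCast 5 n).symm
  constructor
  · rw [hn, ← Real.rpow_neg h5.le, ← Real.rpow_mul h5.le, ← Real.rpow_add h5]
    congr 1
    push_cast
    ring
  · rw [inv_inv, hn, ← Real.rpow_mul h5.le, ← Real.rpow_add h5]
    congr 1
    ring

/-- A real function with `∫ f² = 1` in `L²` has `‖f‖_{L²} = 1` (`eLpNorm`). [folklore] -/
theorem eLpNorm_two_eq_one_of_integral_sq {α : Type*} [MeasurableSpace α] {μ : Measure α}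
    {f : α → ℝ} (hf : MemLp f 2 μ) (h : ∫ x, f x ^ 2 ∂μ = 1) : eLpNorm f 2 μ = 1 := by
  rw [hf.eLpNorm_eq_integral_rpow_norm two_ne_zero ENNReal.ofNat_ne_top]
  have h2 : ∫ a, ‖f a‖ ^ (2 : ℝ≥0∞).toReal ∂μ = 1 := by
    rw [← h]
    refine integral_congr_ae (ae_of_all _ fun x => ?_)
    simp only [ENNReal.toReal_ofNat, Real.rpow_two, Real.norm_eq_abs, sq_abs]
  rw [h2]
  simp

end AlbertiCrippaMazzucato

/-! ## The reduction: planar family ⇒ torus family -/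

section Reduction

variable {F' : Type*} [NormedAddCommGroup F'] [NormedSpace ℝ F']

/-- **Scaling bookkeeping for (a) / (4.10).** For a planar field `u` on `[0,1] × ℝ²` (smooth,
vanishing off a closed `K ⊆ (0,1)²` at times in `S`) whose time-derivative slices obey the
integer-order bounds `‖Dⁱ ∂ₜᵏ|_S u(·,·)(t)‖_∞ ≤ Cᵢ 5^{(i-1)n}`, `i ≤ j + 1`, the `C^{j,r}(T²)` norm
of `x ↦ ∂ₜᵏ|_S U(·, x)(t)`, `U = periodize ∘ u`, is at most
`(Σ_{i ≤ j} |Cᵢ| + |C_{j+1}| + 2|C_j|) 5^{(j+r-1)n}` (interpolation at scale `δ = 5⁻ⁿ`,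
`eContDiffHolderNorm_iteratedDerivWithin_periodize_le`; Bruè–De Lellis 2023, Thm. 4.1 (a)).
[cite: BrueDeLellisCMP2023, Thm. 4.1 (a)] -/
theorem eContDiffHolderNorm_periodize_le_of_scaling {S : Set ℝ} (hS : UniqueDiffOn ℝ S)
    {u : ℝ → EuclideanSpace ℝ (Fin 2) → F'} (hu : ContDiffOn ℝ ∞ (uncurry u) (S ×ˢ univ))
    {K : Set (EuclideanSpace ℝ (Fin 2))} (hK : IsClosed K)
    (hKsub : K ⊆ {y | ∀ i, y i ∈ Ioo (0 : ℝ) 1}) (h0 : ∀ t ∈ S, ∀ y ∉ K, u t y = 0)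
    {j k : ℕ} {r : ℝ≥0} (hr : r ≤ 1) (C : ℕ → ℝ) (n : ℕ) {t : ℝ} (ht : t ∈ S)
    (hC : ∀ i ≤ j + 1, ∀ z,
      ‖iteratedFDeriv ℝ i (fun z => iteratedDerivWithin k (fun s => u s z) S t) z‖ ≤
        C i * (5 : ℝ) ^ (((i : ℝ) - 1) * n)) :
    Torus.eContDiffHolderNorm j r (fun x => iteratedDerivWithin k (fun s => periodize (u s) x) S t) ≤
      ENNReal.ofReal (((∑ i ∈ Finset.range (j + 1), |C i|) + |C (j + 1)| + 2 * |C j|) *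
        (5 : ℝ) ^ (((j : ℝ) + r - 1) * n)) := by
  set M : ℕ → ℝ := fun i => |C i| * (5 : ℝ) ^ (((i : ℝ) - 1) * n) with hM
  have h5 : ∀ x : ℝ, (0 : ℝ) ≤ (5 : ℝ) ^ x := fun x => Real.rpow_nonneg (by norm_num) x
  have hM0 : ∀ i, 0 ≤ M i := fun i => mul_nonneg (abs_nonneg _) (h5 _)
  have hMb : ∀ i ≤ j + 1, ∀ z,
      ‖iteratedFDeriv ℝ i (fun z => iteratedDerivWithin k (fun s => u s z) S t) z‖ ≤ M i :=
    fun i hi z => (hC i hi z).trans (mul_le_mul_of_nonneg_right (le_abs_self _) (h5 _))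
  have hδ : (0 : ℝ) < ((5 : ℝ) ^ n)⁻¹ := by positivity
  refine (eContDiffHolderNorm_iteratedDerivWithin_periodize_le hu hS hK hKsub h0 ht hM0 hMb hr
    hδ).trans (ENNReal.ofReal_le_ofReal ?_)
  set e : ℝ := (5 : ℝ) ^ (((j : ℝ) + r - 1) * n) with he
  have h1 : ∑ i ∈ Finset.range (j + 1), M i ≤ (∑ i ∈ Finset.range (j + 1), |C i|) * e := by
    rw [Finset.sum_mul]
    refine Finset.sum_le_sum fun i hi => mul_le_mul_of_nonneg_left ?_ (abs_nonneg _)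
    exact AlbertiCrippaMazzucato.five_rpow_scale_mono (Nat.lt_succ_iff.1 (Finset.mem_range.1 hi)) r.coe_nonneg n
  have h2 : M (j + 1) * ((5 : ℝ) ^ n)⁻¹ ^ (1 - r : ℝ) = |C (j + 1)| * e := by
    simp only [hM]
    rw [mul_assoc, (AlbertiCrippaMazzucato.five_rpow_scale_interpolate n j r).1]
  have h3 : 2 * M j * (((5 : ℝ) ^ n)⁻¹)⁻¹ ^ (r : ℝ) = 2 * |C j| * e := by
    simp only [hM]
    rw [he, ← (AlbertiCrippaMazzucato.five_rpow_scale_interpolate n j r).2]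
    ring
  rw [h2, h3]
  have h4 : ((∑ i ∈ Finset.range (j + 1), |C i|) + |C (j + 1)| + 2 * |C j|) * e =
      (∑ i ∈ Finset.range (j + 1), |C i|) * e + (|C (j + 1)| * e + 2 * |C j| * e) := by ring
  rw [h4]
  exact add_le_add h1 le_rfl

end Reduction

/-- **The per-level torus family from the planar family.** Bruè–De Lellis 2023, Thm. 4.1 in
its native planar setting (`alberti_crippa_mazzucato_planar_family`, `QuasiSelfSimilarPlanar.lean`:
`C^∞` fields on `[0,1] × ℝ²` supported in compacts `K_n ⋐ (0,1)²`, transport + incompressibility,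
integer-order bounds (a)/(4.9)–(4.10), item (b) with zero averages on the cells of mesh
`(2·5ⁿ)⁻¹`, handover (d)), made `1`-periodic by slice-wise periodisation (BDL §5, first
paragraph), is a family in the sense of `alberti_crippa_mazzucato_family`: the fractional Hölder
bounds follow by interpolation at scale `5⁻ⁿ` (`eContDiffHolderNorm_periodize_le_of_scaling`),
and the mixing bound `‖ρ_n(t)‖_{Ḣ⁻¹} ≤ C 5⁻ⁿ` from the vanishing cell averages
(`Torus.eHomSobolevSeminorm_neg_one_le_of_cellAverage_eq_zero`, taken as the hypothesis `hP`)
and `‖ρ_n(t)‖_{L²} = 1`. [cite: BrueDeLellisCMP2023, Thm. 4.1 and §5 (first paragraph)] -/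
theorem alberti_crippa_mazzucato_family_of_planar (h : alberti_crippa_mazzucato_planar_family)
    (hP : Torus.eHomSobolevSeminorm_neg_one_le_of_cellAverage_eq_zero (Fin 2)) :
    alberti_crippa_mazzucato_family := by
  obtain ⟨ρ, v, hsm, hK, htr, ha, ha', hb, hgrad, hcell, hd⟩ := h
  choose K hKc hKsub hK0 using hK
  choose Ca hCa using ha
  choose Cb hCb using ha'
  obtain ⟨Cg, hCg⟩ := hgrad
  obtain ⟨C0, hC0⟩ := hP
  have hKcl : ∀ n, IsClosed (K n) := fun n => (hKc n).isClosed
  have hρ0 : ∀ n, ∀ t ∈ Icc (0 : ℝ) 1, ∀ y ∉ K n, ρ n t y = 0 := fun n t ht y hy => (hK0 n t ht y hy).1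
  have hv0 : ∀ n, ∀ t ∈ Icc (0 : ℝ) 1, ∀ y ∉ K n, v n t y = 0 := fun n t ht y hy => (hK0 n t ht y hy).2
  have hρ0' : ∀ n, ∀ t ∈ Icc (0 : ℝ) 1, ∀ y, (¬ ∀ i, y i ∈ Ioo (0 : ℝ) 1) → ρ n t y = 0 :=
    fun n t ht y hy => hρ0 n t ht y fun hyK => hy (hKsub n hyK)
  have hv0' : ∀ n, ∀ t ∈ Icc (0 : ℝ) 1, ∀ y, (¬ ∀ i, y i ∈ Ioo (0 : ℝ) 1) → v n t y = 0 :=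
    fun n t ht y hy => hv0 n t ht y fun hyK => hy (hKsub n hyK)
  have hS : UniqueDiffOn ℝ (Icc (0 : ℝ) 1) := uniqueDiffOn_Icc_zero_one
  have hρs : ∀ n, ContDiffOn ℝ ∞ (uncurry (ρ n)) (Icc 0 1 ×ˢ univ) := fun n => (hsm n).1
  have hvs : ∀ n, ContDiffOn ℝ ∞ (uncurry (v n)) (Icc 0 1 ×ˢ univ) := fun n => (hsm n).2
  -- the torus fields
  refine ⟨fun n t => periodize (ρ n t), fun n t => periodize (v n t), fun n => ⟨?_, ?_, ?_, ?_⟩,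
    ?_, ?_, ?_, ?_, ?_, ?_⟩
  · exact isSmoothSpaceTimeOn_periodize (hvs n) (hKcl n) (hKsub n) (hv0 n)
  · exact isSmoothSpaceTimeOn_periodize (hρs n) (hKcl n) (hKsub n) (hρ0 n)
  · intro t ht x
    beta_reduce
    rw [timeDerivWithin_periodize_slice (hKcl n) (hKsub n) (hρ0 n) ht x,
      gradient_periodize_slice (hρs n) (hKcl n) (hKsub n) (hρ0 n) ht x,
      periodize_slice_apply (hKcl n) (hKsub n) (hv0 n t ht) x, zero_mul]
    exact (htr n t ht (repr x)).1
  · intro t ht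
    exact isDivFree_periodize_slice (hvs n) (hKcl n) (hKsub n) (hv0 n) ht fun z => (htr n t ht z).2
  · -- (a)
    intro j k r hr
    beta_reduce
    refine ⟨(∑ i ∈ Finset.range (j + 1), |Ca i k|) + |Ca (j + 1) k| + 2 * |Ca j k|,
      fun n t ht => ?_⟩
    exact eContDiffHolderNorm_periodize_le_of_scaling hS (hvs n) (hKcl n) (hKsub n) (hv0 n) hr.le
      (fun i => Ca i k) n ht fun i _ z => hCa i k n t ht z
  · -- (4.9)–(4.10)
    intro j k r hr _
    beta_reduce
    refine ⟨(∑ i ∈ Finset.range (j + 1), |Cb i k|) + |Cb (j + 1) k| + 2 * |Cb j k|,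
      fun n t ht => ?_⟩
    -- the planar convective field
    set c : ℝ → EuclideanSpace ℝ (Fin 2) → EuclideanSpace ℝ (Fin 2) :=
      fun s z => _root_.fderiv ℝ (v n s) z (v n s z) with hc
    have hcs : ContDiffOn ℝ ∞ (uncurry c) (Icc 0 1 ×ˢ univ) := (hvs n).contDiffOn_convect_slice hS
    have hc0 : ∀ s ∈ Icc (0 : ℝ) 1, ∀ y ∉ K n, c s y = 0 := fun s hs y hy => by
      simp [hc, hv0 n s hs y hy]
    have hfun : (fun x => iteratedDerivWithin k
        (fun s => Torus.convect (periodize (v n s)) (periodize (v n s)) x) (Icc 0 1) t) =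
        fun x => iteratedDerivWithin k (fun s => periodize (c s) x) (Icc 0 1) t := by
      funext x
      refine iteratedDerivWithin_congr (fun s hs => ?_) ht
      rw [convect_periodize_slice (hvs n) (hKcl n) (hKsub n) (hv0 n) hs x,
        periodize_slice_apply (u := c) (hKcl n) (hKsub n) (hc0 s hs) x]
    rw [hfun]
    exact eContDiffHolderNorm_periodize_le_of_scaling hS hcs (hKcl n) (hKsub n) hc0 hr.le
      (fun i => Cb i k) n ht fun i _ z => hCb i k n t ht z
  · -- (b): mean zero, unit L² mass, sup bound
    intro n t ht
    beta_reduce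
    have hcont : Continuous (ρ n t) := ((hρs n).contDiff_slice ht).continuous
    refine ⟨?_, ?_, fun x => ?_⟩
    · show ∫ x, periodize (ρ n t) x = 0
      rw [integral_periodize_of_cube hcont (hKcl n) (hKsub n) (hρ0 n t ht)]
      exact (hb n t ht).1
    · rw [integral_periodize_sq_of_cube hcont (hKcl n) (hKsub n) (hρ0 n t ht)]
      exact (hb n t ht).2.1
    · rw [periodize_slice_apply (hKcl n) (hKsub n) (hρ0 n t ht) x]
      exact (hb n t ht).2.2 _
  · -- gradient bound and the mixing norm
    refine ⟨max Cg (C0 / 2), fun n t ht => ⟨fun x => ?_, ?_⟩⟩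
    · beta_reduce
      rw [gradient_periodize_slice (hρs n) (hKcl n) (hKsub n) (hρ0 n) ht x]
      exact (hCg n t ht (repr x)).trans
        (mul_le_mul_of_nonneg_right (le_max_left _ _) (by positivity))
    · beta_reduce
      have hsmooth : IsSmooth (periodize (ρ n t)) :=
        (isSmoothSpaceTimeOn_periodize (hρs n) (hKcl n) (hKsub n) (hρ0 n)).isSmooth_slice ht
      have hcont : Continuous (ρ n t) := ((hρs n).contDiff_slice ht).continuous
      have hN : 0 < 2 * 5 ^ n := by positivity
      have hcells : ∀ m : Fin 2 → ℤ, ∫ y in {y : EuclideanSpace ℝ (Fin 2) |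
          ((2 * 5 ^ n : ℕ) : ℝ) • y - latticeVec m ∈ unitCube (Fin 2)},
            periodize (ρ n t) (proj y) = 0 := by
        intro m
        simp only [periodize_proj]
        exact setIntegral_gridCell_perSum_eq_zero (hρ0' n t ht) hN (hcell n t ht) m
      have hL2 : eLpNorm (periodize (ρ n t)) 2 volume = 1 :=
        AlbertiCrippaMazzucato.eLpNorm_two_eq_one_of_integral_sq (hsmooth.memLp 2)
          (by rw [integral_periodize_sq_of_cube hcont (hKcl n) (hKsub n) (hρ0 n t ht)]
              exact (hb n t ht).2.1)
      refine (hC0 (2 * 5 ^ n) hN _ (hsmooth.memLp 2) hcells).trans ?_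
      rw [hL2, mul_one]
      refine ENNReal.ofReal_le_ofReal ?_
      have h5 : (0 : ℝ) < 5 ^ n := by positivity
      rw [show C0 / ((2 * 5 ^ n : ℕ) : ℝ) = C0 / 2 * (5 ^ n)⁻¹ by push_cast; ring]
      exact mul_le_mul_of_nonneg_right (le_max_right _ _) (by positivity)
  · -- (c): per-level supports
    intro n
    refine ⟨K n, hKc n, hKsub n, fun t ht y hy hyK => ⟨?_, ?_⟩⟩
    · beta_reduce
      rw [periodize_proj, perSum_eq_self_of_mem_unitCube (hv0' n t ht) hy]
      exact hv0 n t ht y hyK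
    · beta_reduce
      rw [periodize_proj, perSum_eq_self_of_mem_unitCube (hρ0' n t ht) hy]
      exact hρ0 n t ht y hyK
  · -- (d): handover
    intro n
    show (fun t => periodize (ρ n t)) 1 = (fun t => periodize (ρ (n + 1) t)) 0
    simp only [hd n]

/-- **The per-level torus family from the planar family, unconditionally in the cell-average
estimate.** Bruè–De Lellis 2023, Thm. 4.1 in its native planar setting
(`alberti_crippa_mazzucato_planar_family`) implies the per-level torus family
`alberti_crippa_mazzucato_family`: `alberti_crippa_mazzucato_family_of_planar` with the
discharged estimate `Torus.eHomSobolevSeminorm_neg_one_le_of_cellAverage_eq_zero_holds (Fin 2)`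
(`TorusCellAveragesDischarge.lean`). What remains hypothetical is exactly the
Alberti–Crippa–Mazzucato construction (JAMS 2019, §§6–8).
[cite: BrueDeLellisCMP2023, Thm. 4.1 and §5 (first paragraph)] -/
theorem alberti_crippa_mazzucato_family_of_planar' (h : alberti_crippa_mazzucato_planar_family) :
    alberti_crippa_mazzucato_family :=
  alberti_crippa_mazzucato_family_of_planar h
    (Torus.eHomSobolevSeminorm_neg_one_le_of_cellAverage_eq_zero_holds (Fin 2))

end Literature.Analysis.FluidPDE

end
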